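import Literature.MathematicalPhysics.QuantumManyBody.DiluteBoseGasTrialLambda
import HarnessLib

/-!
# The BCS trial state: bounds for the quasi-free remainders

Topic `Literature/MathematicalPhysics/QuantumManyBody`, namespace `BoseGas.BCSTrial`; theorem-only, for
the provefact `Literature.MathematicalPhysics.QuantumManyBody.BoseGas.BastiCenatiempoSchlein2021_upperBound`.

Off `P_L` the pair amplitude is `t_p = η_p` itself once `|η_p| ≤ ½` (guaranteed by
`W(0)ρ^{1/5}/(8π²) ≤ ½`), so `σ_p² - η_p² = η_p⁴/(1-η_p²)` and `γ_pσ_p - η_p = η_p³/(1-η_p²)`. With the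
lattice sums of `DiluteBoseGasTrialSums.lean` and the convolution sups of
`DiluteBoseGasTrialLambda.lean` this controls the nine remainders `A₁,…,A₉` of
`ScalarResummation.quasiFree_identity` for the concrete data, each by `C(v)·ρ^{-7/10}`
(the precision `ρ^{5/2+1/10}L³` of Prop. 1.3 of [BastiCenatiempoSchlein2021] in the box).

## References

* [BastiCenatiempoSchlein2021] G. Basti, S. Cenatiempo, B. Schlein, Forum Math. Sigma 9 (2021) e74,
  arXiv:2101.06222: Prop. 1.3, §5 (first page: the terms of (3.20)–(3.23) not written out).
-/

noncomputable section

namespace Literature.MathematicalPhysics.QuantumManyBody.BoseGas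

open MeasureTheory Complex Finset
open scoped ENNReal BigOperators

namespace BCSTrial

variable {v : ℝ → ℝ≥0∞} {ρ : ℝ}

/-! ### One more tail sum -/

/-- **`∑_{p : |n|² > A} |n|⁻⁶ ≤ 192(√3)³/(√A)³`** (`A > 0`). [folklore] -/
theorem sum_inv_nsq_cube_le {M : ℕ} (s : Finset (ModeBox M)) {A : ℝ} (hA : 0 < A)
    (hs : ∀ p ∈ s, A < nsq (e M p)) :
    ∑ p ∈ s, (nsq (e M p) ^ 3)⁻¹ ≤ 192 * Real.sqrt 3 ^ 3 / Real.sqrt A ^ 3 := by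
  set N := ⌊Real.sqrt (A / 3)⌋₊ + 1 with hN
  have hN1 : 1 ≤ N := Nat.le_add_left 1 _
  calc ∑ p ∈ s, (nsq (e M p) ^ 3)⁻¹
      ≤ ∑ p ∈ s, ((((univ.sup fun j => (e M p j).natAbs : ℕ)) : ℝ) ^ 6)⁻¹ := by
        refine Finset.sum_le_sum fun p hp => ?_
        have h0 : 0 < nsq (e M p) := hA.trans (hs p hp)
        have h1 := one_le_supNorm h0
        have h1' : (1 : ℝ) ≤ (((univ.sup fun j => (e M p j).natAbs : ℕ)) : ℝ) := by exact_mod_cast h1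
        refine inv_anti₀ (by positivity) ?_
        calc ((((univ.sup fun j => (e M p j).natAbs : ℕ)) : ℝ) ^ 6) = ((((univ.sup fun j => (e M p j).natAbs : ℕ)) : ℝ) ^ 2) ^ 3 := by ring
          _ ≤ nsq (e M p) ^ 3 := pow_le_pow_left₀ (sq_nonneg _) (supNorm_sq_le_nsq' _) 3
    _ = ∑ n ∈ s.map ⟨e M, e_injective M⟩, ((((univ.sup fun j => (n j).natAbs : ℕ)) : ℝ) ^ 6)⁻¹ :=
        sum_eq_sum_map s (fun n => ((((univ.sup fun j => (n j).natAbs : ℕ)) : ℝ) ^ 6)⁻¹)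
    _ = ∑ n ∈ (s.map ⟨e M, e_injective M⟩).filter (fun n => N ≤ (univ.sup fun j => (n j).natAbs)),
          ((((univ.sup fun j => (n j).natAbs : ℕ)) : ℝ) ^ 6)⁻¹ := by
        rw [Finset.filter_true_of_mem]
        intro n hn
        rw [Finset.mem_map] at hn
        obtain ⟨p, hp, rfl⟩ := hn
        exact floor_sqrt_lt_supNorm hA.le (hs p hp)
    _ ≤ 192 / (N : ℝ) ^ 3 := sum_inv_supNorm_pow_six_le _ hN1
    _ ≤ 192 * Real.sqrt 3 ^ 3 / Real.sqrt A ^ 3 := by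
        have hsA : 0 < Real.sqrt A := Real.sqrt_pos.2 hA
        have hs3 : 0 < Real.sqrt (A / 3) := Real.sqrt_pos.2 (by positivity)
        have hNgt : Real.sqrt (A / 3) < N := by rw [hN]; push_cast; exact Nat.lt_floor_add_one _
        have h3 : Real.sqrt A = Real.sqrt 3 * Real.sqrt (A / 3) := by
          rw [← Real.sqrt_mul (by norm_num)]; congr 1; ring
        rw [h3, mul_pow, div_le_div_iff₀ (by positivity) (by positivity)]
        have hN3 : Real.sqrt (A / 3) ^ 3 ≤ (N : ℝ) ^ 3 := pow_le_pow_left₀ hs3.le hNgt.le 3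
        nlinarith [hN3, pow_pos hs3 3, pow_pos (Real.sqrt_pos.2 (by norm_num : (0:ℝ) < 3)) 3]

/-! ### Off `P_L`: the clip is inactive -/

section OffLow

variable (hv : Measurable v) (hint : (∫⁻ x : Space, v ‖x‖) ≠ ⊤) (hρ : 0 < ρ)
include hv hint hρ

/-- Off `P_L`: **`|η_p| ≤ (W(0)/(8π²))ρ^{1/5}`** (`|n|² > ρ^{-7/5}` or `p = z`). [cite: BastiCenatiempoSchlein2021, (2.4)] -/
theorem abs_eta_le_of_not_lowSet {p : ModeBox (boxSize ρ)} (hp : p ∉ lowSet ρ) :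
    |eta v ρ p| ≤ W v ρ 0 / (8 * Real.pi ^ 2) * ρ ^ ((1 : ℝ) / 5) := by
  have hW0 := W_zero_nonneg v ρ
  by_cases hpz : p = z _
  · rw [hpz, eta_z, abs_zero]; positivity
  · have h := abs_eta_le hv hint hρ hpz
    have hn1 : 1 ≤ nsq (e _ p) := one_le_nsq (fun h0 => hpz ((e_eq_zero_iff _ p).1 h0))
    have hn : ρ ^ (-(7 : ℝ) / 5) < nsq (e _ p) := by
      by_contra hle; exact hp (mem_lowSet.2 ⟨by linarith, le_of_not_gt hle⟩)
    have hL := boxSide_pos hρ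
    refine h.trans ?_
    rw [boxSide_sq hρ]
    have h75 : 0 < ρ ^ (-(7 : ℝ) / 5) := Real.rpow_pos_of_pos hρ _
    calc ρ * W v ρ 0 * ρ ^ (-(11 : ℝ) / 5) / (8 * Real.pi ^ 2 * nsq (e _ p))
        ≤ ρ * W v ρ 0 * ρ ^ (-(11 : ℝ) / 5) / (8 * Real.pi ^ 2 * ρ ^ (-(7 : ℝ) / 5)) :=
          div_le_div_of_nonneg_left (by positivity) (by positivity) (by nlinarith [Real.pi_pos])
      _ = W v ρ 0 / (8 * Real.pi ^ 2) * (ρ * ρ ^ (-(11 : ℝ) / 5) / ρ ^ (-(7 : ℝ) / 5)) := by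
          field_simp
      _ = _ := by
          congr 1
          rw [div_eq_iff h75.ne', ← Real.rpow_add hρ,
            show (ρ : ℝ) * ρ ^ (-(11 : ℝ) / 5) = ρ ^ (1 : ℝ) * ρ ^ (-(11 : ℝ) / 5) by rw [Real.rpow_one], ← Real.rpow_add hρ]
          norm_num

/-- Off `P_L`, under `W(0)ρ^{1/5}/(8π²) ≤ ½`: **`t_p = η_p`**. [folklore] -/
theorem tAmp_eq_eta (hsmall : W v ρ 0 / (8 * Real.pi ^ 2) * ρ ^ ((1 : ℝ) / 5) ≤ 1 / 2)
    {p : ModeBox (boxSize ρ)} (hp : p ∉ lowSet ρ) : tAmp v ρ p = eta v ρ p := by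
  unfold tAmp; rw [if_neg hp]
  exact clip_of_abs_le ((abs_eta_le_of_not_lowSet hv hint hρ hp).trans hsmall)

/-- Off `P_L`, under the smallness condition: **`σ_p² - η_p² = η_p⁴/(1-η_p²) ∈ [0, (4/3)η_p⁴]`** and
**`|γ_pσ_p - η_p| ≤ (4/3)|η_p|³`**. [cite: BastiCenatiempoSchlein2021, §2 ("`σ_H ≈ η_H`")] -/
theorem angles_sub_eta (hsmall : W v ρ 0 / (8 * Real.pi ^ 2) * ρ ^ ((1 : ℝ) / 5) ≤ 1 / 2)
    {p : ModeBox (boxSize ρ)} (hp : p ∉ lowSet ρ) :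
    0 ≤ Fock.bogSigma (neg _) (halfSpace _) (tAmp v ρ) p ^ 2 - eta v ρ p ^ 2 ∧
      Fock.bogSigma (neg _) (halfSpace _) (tAmp v ρ) p ^ 2 - eta v ρ p ^ 2 ≤ 4 / 3 * eta v ρ p ^ 4 ∧
      |Fock.bogGamma (neg _) (halfSpace _) (tAmp v ρ) p * Fock.bogSigma (neg _) (halfSpace _) (tAmp v ρ) p - eta v ρ p| ≤
        4 / 3 * |eta v ρ p| ^ 3 := by
  have ht := tAmp_eq_eta hv hint hρ hsmall hp
  have hη : |eta v ρ p| ≤ 1 / 2 := (abs_eta_le_of_not_lowSet hv hint hρ hp).trans hsmall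
  have hη2 : eta v ρ p ^ 2 ≤ 1 / 4 := by
    rw [← sq_abs]; nlinarith [abs_nonneg (eta v ρ p)]
  have hpos : 0 < 1 - eta v ρ p ^ 2 := by linarith
  have hinv : (1 - eta v ρ p ^ 2)⁻¹ ≤ 4 / 3 := by rw [inv_le_comm₀ hpos (by norm_num)]; linarith
  have hs : Fock.bogSigma (neg _) (halfSpace _) (tAmp v ρ) p ^ 2 = eta v ρ p ^ 2 / (1 - eta v ρ p ^ 2) := by
    rw [bogSigma_sq_eq hv hint hρ, ht]
  have hg : Fock.bogGamma (neg _) (halfSpace _) (tAmp v ρ) p * Fock.bogSigma (neg _) (halfSpace _) (tAmp v ρ) p =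
      eta v ρ p / (1 - eta v ρ p ^ 2) := by
    rw [bogGamma_mul_bogSigma_eq hv hint hρ, ht]
  have hd : eta v ρ p ^ 2 / (1 - eta v ρ p ^ 2) - eta v ρ p ^ 2 = eta v ρ p ^ 4 * (1 - eta v ρ p ^ 2)⁻¹ := by
    field_simp; ring
  refine ⟨?_, ?_, ?_⟩
  · rw [hs, hd]; positivity
  · rw [hs, hd]
    calc eta v ρ p ^ 4 * (1 - eta v ρ p ^ 2)⁻¹ ≤ eta v ρ p ^ 4 * (4 / 3) := mul_le_mul_of_nonneg_left hinv (by positivity)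
      _ = _ := by ring
  · rw [hg, show eta v ρ p / (1 - eta v ρ p ^ 2) - eta v ρ p = eta v ρ p ^ 3 * (1 - eta v ρ p ^ 2)⁻¹ by field_simp; ring,
      abs_mul, abs_inv, abs_of_pos hpos, abs_pow]
    calc |eta v ρ p| ^ 3 * (1 - eta v ρ p ^ 2)⁻¹ ≤ |eta v ρ p| ^ 3 * (4 / 3) := mul_le_mul_of_nonneg_left hinv (by positivity)
      _ = _ := by ring

end OffLow

/-! ### Sums of powers of `η` off `P_L` -/

section EtaSums

variable (hv : Measurable v) (hint : (∫⁻ x : Space, v ‖x‖) ≠ ⊤) (hρ : 0 < ρ)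
include hv hint hρ

omit hv hint hρ in
/-- The complement `L^c = {p ≠ z, p ∉ P_L}` has `|n|² > ρ^{-7/5}`. [folklore] -/
theorem nsq_gt_of_mem_compl {p : ModeBox (boxSize ρ)} (hp : p ∈ (Finset.univ \ insert (z (boxSize ρ)) (lowSet ρ))) :
    ρ ^ (-(7 : ℝ) / 5) < nsq (e _ p) ∧ p ≠ z _ ∧ p ∉ lowSet ρ := by
  rw [Finset.mem_sdiff, Finset.mem_insert, not_or] at hp
  have hpz := hp.2.1
  have hn1 : 1 ≤ nsq (e _ p) := one_le_nsq (fun h0 => hpz ((e_eq_zero_iff _ p).1 h0))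
  refine ⟨?_, hpz, hp.2.2⟩
  by_contra hle; exact hp.2.2 (mem_lowSet.2 ⟨by linarith, le_of_not_gt hle⟩)

/-- **`∑_{L^c} η² ≤ (3√3/π⁴)W(0)²ρ^{-17/10}`.** [cite: BastiCenatiempoSchlein2021, (2.4)] -/
theorem sum_compl_eta_sq_le :
    ∑ p ∈ (Finset.univ \ insert (z (boxSize ρ)) (lowSet ρ)), eta v ρ p ^ 2 ≤
      3 * Real.sqrt 3 / Real.pi ^ 4 * W v ρ 0 ^ 2 * ρ ^ (-(17 : ℝ) / 10) := by
  have hL := boxSide_pos hρ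
  have hW0 := W_zero_nonneg v ρ
  set B : ℝ := ρ ^ (-(7 : ℝ) / 5) with hB
  have hB0 : 0 < B := Real.rpow_pos_of_pos hρ _
  calc _ ≤ ∑ p ∈ (Finset.univ \ insert (z (boxSize ρ)) (lowSet ρ)),
        ρ ^ 2 * W v ρ 0 ^ 2 * boxSide ρ ^ 4 / (64 * Real.pi ^ 4) * (nsq (e _ p) ^ 2)⁻¹ :=
        Finset.sum_le_sum fun p hp => eta_sq_le_inv_nsq_sq hv hint hρ (nsq_gt_of_mem_compl hp).2.1
    _ = ρ ^ 2 * W v ρ 0 ^ 2 * boxSide ρ ^ 4 / (64 * Real.pi ^ 4) *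
        ∑ p ∈ (Finset.univ \ insert (z (boxSize ρ)) (lowSet ρ)), (nsq (e _ p) ^ 2)⁻¹ := by rw [Finset.mul_sum]
    _ ≤ ρ ^ 2 * W v ρ 0 ^ 2 * boxSide ρ ^ 4 / (64 * Real.pi ^ 4) * (192 * Real.sqrt 3 / Real.sqrt B) :=
        mul_le_mul_of_nonneg_left (sum_inv_nsq_sq_le _ hB0 fun p hp => (nsq_gt_of_mem_compl hp).1) (by positivity)
    _ = _ := by
        rw [div_eq_mul_inv (192 * Real.sqrt 3), hB, show (-(7 : ℝ) / 5) = -((7 : ℝ) / 5) by ring, inv_sqrt_rpow_neg hρ,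
          show ((7 : ℝ) / 5 / 2) = (7 : ℝ) / 10 by norm_num, ← rpow_combo₃ hρ]
        field_simp
        ring

/-- **`∑_{L^c} |η|³ ≤ (9√3/(8π⁶))W(0)³ρ^{-3/2}`** (`c³·192(√3)³ρ^{21/10}`, `c = ρW(0)L²/(8π²)`).
[cite: BastiCenatiempoSchlein2021, (2.4)] -/
theorem sum_compl_abs_eta_cube_le :
    ∑ p ∈ (Finset.univ \ insert (z (boxSize ρ)) (lowSet ρ)), |eta v ρ p| ^ 3 ≤
      9 * Real.sqrt 3 / (8 * Real.pi ^ 6) * W v ρ 0 ^ 3 * ρ ^ (-(3 : ℝ) / 2) := by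
  have hL := boxSide_pos hρ
  have hW0 := W_zero_nonneg v ρ
  set B : ℝ := ρ ^ (-(7 : ℝ) / 5) with hB
  have hB0 : 0 < B := Real.rpow_pos_of_pos hρ _
  set c : ℝ := ρ * W v ρ 0 * boxSide ρ ^ 2 / (8 * Real.pi ^ 2) with hc
  have hc0 : 0 ≤ c := by positivity
  calc _ ≤ ∑ p ∈ (Finset.univ \ insert (z (boxSize ρ)) (lowSet ρ)), c ^ 3 * (nsq (e _ p) ^ 3)⁻¹ := by
        refine Finset.sum_le_sum fun p hp => ?_
        obtain ⟨hn, hpz, -⟩ := nsq_gt_of_mem_compl hp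
        have hnp : 0 < nsq (e _ p) := hB0.trans hn
        have h := abs_eta_le hv hint hρ hpz
        have h' : |eta v ρ p| ≤ c * (nsq (e _ p))⁻¹ := by rw [hc]; convert h using 1; field_simp
        calc |eta v ρ p| ^ 3 ≤ (c * (nsq (e _ p))⁻¹) ^ 3 := pow_le_pow_left₀ (abs_nonneg _) h' 3
          _ = c ^ 3 * (nsq (e _ p) ^ 3)⁻¹ := by rw [mul_pow, inv_pow]
    _ = c ^ 3 * ∑ p ∈ (Finset.univ \ insert (z (boxSize ρ)) (lowSet ρ)), (nsq (e _ p) ^ 3)⁻¹ := by rw [Finset.mul_sum]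
    _ ≤ c ^ 3 * (192 * Real.sqrt 3 ^ 3 / Real.sqrt B ^ 3) :=
        mul_le_mul_of_nonneg_left (sum_inv_nsq_cube_le _ hB0 fun p hp => (nsq_gt_of_mem_compl hp).1) (by positivity)
    _ = _ := by
        have hsB : Real.sqrt B ^ 3 = ρ ^ (-(21 : ℝ) / 10) := by
          rw [hB, Real.sqrt_eq_rpow, ← Real.rpow_mul hρ.le, ← Real.rpow_natCast, ← Real.rpow_mul hρ.le]; norm_num
        have hc3 : c ^ 3 = (W v ρ 0 / (8 * Real.pi ^ 2)) ^ 3 * ρ ^ (-(18 : ℝ) / 5) := by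
          rw [hc, boxSide_sq hρ]
          have : (ρ * W v ρ 0 * ρ ^ (-(11 : ℝ) / 5) / (8 * Real.pi ^ 2)) = (W v ρ 0 / (8 * Real.pi ^ 2)) * (ρ * ρ ^ (-(11 : ℝ) / 5)) := by
            ring
          rw [this, mul_pow]
          congr 1
          rw [show (ρ : ℝ) * ρ ^ (-(11 : ℝ) / 5) = ρ ^ (1 : ℝ) * ρ ^ (-(11 : ℝ) / 5) by rw [Real.rpow_one], ← Real.rpow_add hρ,
            ← Real.rpow_natCast, ← Real.rpow_mul hρ.le]
          norm_num
        have hs33 : Real.sqrt 3 ^ 3 = 3 * Real.sqrt 3 := by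
          rw [pow_succ, Real.sq_sqrt (by norm_num : (0:ℝ) ≤ 3)]
        have hkey : ρ ^ (-(18 : ℝ) / 5) = ρ ^ (-(21 : ℝ) / 10) * ρ ^ (-(3 : ℝ) / 2) := by
          rw [← Real.rpow_add hρ]; norm_num
        rw [hsB, hc3, hs33, hkey]
        have h21 : 0 < ρ ^ (-(21 : ℝ) / 10) := Real.rpow_pos_of_pos hρ _
        field_simp
        ring

/-- **`∑_{L^c} ε η⁴ ≤ (9√3/(16π⁶))W(0)⁴ρ^{-1/2}`** (`(4π²/L²)c⁴·192(√3)³ρ^{21/10}`).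
[cite: BastiCenatiempoSchlein2021, (2.4)] -/
theorem sum_compl_eps_eta_four_le :
    ∑ p ∈ (Finset.univ \ insert (z (boxSize ρ)) (lowSet ρ)), eps ρ p * eta v ρ p ^ 4 ≤
      9 * Real.sqrt 3 / (16 * Real.pi ^ 6) * W v ρ 0 ^ 4 * ρ ^ (-(1 : ℝ) / 2) := by
  have hL := boxSide_pos hρ
  have hW0 := W_zero_nonneg v ρ
  set B : ℝ := ρ ^ (-(7 : ℝ) / 5) with hB
  have hB0 : 0 < B := Real.rpow_pos_of_pos hρ _
  set c : ℝ := ρ * W v ρ 0 * boxSide ρ ^ 2 / (8 * Real.pi ^ 2) with hc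
  have hc0 : 0 ≤ c := by positivity
  calc _ ≤ ∑ p ∈ (Finset.univ \ insert (z (boxSize ρ)) (lowSet ρ)),
        4 * Real.pi ^ 2 / boxSide ρ ^ 2 * c ^ 4 * (nsq (e _ p) ^ 3)⁻¹ := by
        refine Finset.sum_le_sum fun p hp => ?_
        obtain ⟨hn, hpz, -⟩ := nsq_gt_of_mem_compl hp
        have hnp : 0 < nsq (e _ p) := hB0.trans hn
        have h := abs_eta_le hv hint hρ hpz
        have h' : |eta v ρ p| ≤ c * (nsq (e _ p))⁻¹ := by rw [hc]; convert h using 1; field_simp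
        have h4 : eta v ρ p ^ 4 ≤ c ^ 4 * (nsq (e _ p) ^ 4)⁻¹ := by
          calc eta v ρ p ^ 4 = |eta v ρ p| ^ 4 := by rw [← abs_pow, abs_of_nonneg (by positivity)]
            _ ≤ (c * (nsq (e _ p))⁻¹) ^ 4 := pow_le_pow_left₀ (abs_nonneg _) h' 4
            _ = c ^ 4 * (nsq (e _ p) ^ 4)⁻¹ := by rw [mul_pow, inv_pow]
        rw [eps_eq]
        calc 4 * Real.pi ^ 2 * nsq (e _ p) / boxSide ρ ^ 2 * eta v ρ p ^ 4
            ≤ 4 * Real.pi ^ 2 * nsq (e _ p) / boxSide ρ ^ 2 * (c ^ 4 * (nsq (e _ p) ^ 4)⁻¹) :=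
              mul_le_mul_of_nonneg_left h4 (by positivity)
          _ = 4 * Real.pi ^ 2 / boxSide ρ ^ 2 * c ^ 4 * (nsq (e _ p) ^ 3)⁻¹ := by field_simp
    _ = 4 * Real.pi ^ 2 / boxSide ρ ^ 2 * c ^ 4 * ∑ p ∈ (Finset.univ \ insert (z (boxSize ρ)) (lowSet ρ)), (nsq (e _ p) ^ 3)⁻¹ := by
        rw [Finset.mul_sum]
    _ ≤ 4 * Real.pi ^ 2 / boxSide ρ ^ 2 * c ^ 4 * (192 * Real.sqrt 3 ^ 3 / Real.sqrt B ^ 3) :=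
        mul_le_mul_of_nonneg_left (sum_inv_nsq_cube_le _ hB0 fun p hp => (nsq_gt_of_mem_compl hp).1) (by positivity)
    _ = _ := by
        have hsB : Real.sqrt B ^ 3 = ρ ^ (-(21 : ℝ) / 10) := by
          rw [hB, Real.sqrt_eq_rpow, ← Real.rpow_mul hρ.le, ← Real.rpow_natCast, ← Real.rpow_mul hρ.le]; norm_num
        have hc4 : c ^ 4 = (W v ρ 0 / (8 * Real.pi ^ 2)) ^ 4 * ρ ^ (-(24 : ℝ) / 5) := by
          rw [hc, boxSide_sq hρ]
          have : (ρ * W v ρ 0 * ρ ^ (-(11 : ℝ) / 5) / (8 * Real.pi ^ 2)) = (W v ρ 0 / (8 * Real.pi ^ 2)) * (ρ * ρ ^ (-(11 : ℝ) / 5)) := by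
            ring
          rw [this, mul_pow]
          congr 1
          rw [show (ρ : ℝ) * ρ ^ (-(11 : ℝ) / 5) = ρ ^ (1 : ℝ) * ρ ^ (-(11 : ℝ) / 5) by rw [Real.rpow_one], ← Real.rpow_add hρ,
            ← Real.rpow_natCast, ← Real.rpow_mul hρ.le]
          norm_num
        have hs33 : Real.sqrt 3 ^ 3 = 3 * Real.sqrt 3 := by
          rw [pow_succ, Real.sq_sqrt (by norm_num : (0:ℝ) ≤ 3)]
        have hkey : ρ ^ (-(24 : ℝ) / 5) = ρ ^ (-(11 : ℝ) / 5) * ρ ^ (-(21 : ℝ) / 10) * ρ ^ (-(1 : ℝ) / 2) := by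
          rw [← Real.rpow_add hρ, ← Real.rpow_add hρ]; norm_num
        rw [hsB, hc4, hs33, boxSide_sq hρ, hkey]
        have h21 : 0 < ρ ^ (-(21 : ℝ) / 10) := Real.rpow_pos_of_pos hρ _
        have h11 : 0 < ρ ^ (-(11 : ℝ) / 5) := Real.rpow_pos_of_pos hρ _
        field_simp
        ring

end EtaSums

/-! ### Generic convolution-sum bounds -/

/-- **`|∑_{p∈s}∑_{q∈t} W(e q - e p) f_p g_q| ≤ W(0)(∑_s|f|)(∑_t|g|)`.** [folklore] -/
theorem abs_sum_sum_W_mul_le {M : ℕ} (s t : Finset (ModeBox M)) (f g : ModeBox M → ℝ) :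
    |∑ p ∈ s, ∑ q ∈ t, W v ρ (e M q - e M p) * (f p * g q)| ≤ W v ρ 0 * ((∑ p ∈ s, |f p|) * ∑ q ∈ t, |g q|) := by
  have hW0 := W_zero_nonneg v ρ
  calc _ ≤ ∑ p ∈ s, |∑ q ∈ t, W v ρ (e M q - e M p) * (f p * g q)| := Finset.abs_sum_le_sum_abs _ _
    _ ≤ ∑ p ∈ s, ∑ q ∈ t, W v ρ 0 * (|f p| * |g q|) := by
        refine Finset.sum_le_sum fun p _ => (Finset.abs_sum_le_sum_abs _ _).trans (Finset.sum_le_sum fun q _ => ?_)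
        rw [abs_mul, abs_mul]
        exact mul_le_mul_of_nonneg_right (abs_W_le v ρ _) (by positivity)
    _ = _ := by rw [Finset.sum_mul_sum, Finset.mul_sum]; exact Finset.sum_congr rfl fun p _ => by rw [Finset.mul_sum]

/-- **`|∑_{l∈s} f_l ∑_{q∈t} W(e q - e l) g_q| ≤ W(0)(∑_s|f|)(∑_t|g|)`.** [folklore] -/
theorem abs_sum_mul_sum_W_le {M : ℕ} (s t : Finset (ModeBox M)) (f g : ModeBox M → ℝ) :
    |∑ l ∈ s, f l * ∑ q ∈ t, W v ρ (e M q - e M l) * g q| ≤ W v ρ 0 * ((∑ p ∈ s, |f p|) * ∑ q ∈ t, |g q|) := by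
  have h := abs_sum_sum_W_mul_le (v := v) (ρ := ρ) s t f g
  convert h using 3 with l _
  rw [Finset.mul_sum]
  exact Finset.sum_congr rfl fun q _ => by ring

/-- **`|∑_{p∈s}∑_{q∈t} W(e q - e p) f_p g_q| ≤ (∑_s|f|)·Λ_g`** with `Λ_g ≥ sup_p ∑_t |W(e q - e p)||g_q|`. [folklore] -/
theorem abs_sum_sum_W_mul_le_sup {M : ℕ} (s t : Finset (ModeBox M)) (f g : ModeBox M → ℝ) {Λg : ℝ}
    (hΛ : ∀ p ∈ s, ∑ q ∈ t, |W v ρ (e M q - e M p)| * |g q| ≤ Λg) :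
    |∑ p ∈ s, ∑ q ∈ t, W v ρ (e M q - e M p) * (f p * g q)| ≤ (∑ p ∈ s, |f p|) * Λg := by
  calc _ ≤ ∑ p ∈ s, |∑ q ∈ t, W v ρ (e M q - e M p) * (f p * g q)| := Finset.abs_sum_le_sum_abs _ _
    _ ≤ ∑ p ∈ s, |f p| * Λg := by
        refine Finset.sum_le_sum fun p hp => (Finset.abs_sum_le_sum_abs _ _).trans ?_
        calc ∑ q ∈ t, |W v ρ (e M q - e M p) * (f p * g q)| = |f p| * ∑ q ∈ t, |W v ρ (e M q - e M p)| * |g q| := by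
              rw [Finset.mul_sum]; exact Finset.sum_congr rfl fun q _ => by rw [abs_mul, abs_mul]; ring
          _ ≤ |f p| * Λg := mul_le_mul_of_nonneg_left (hΛ p hp) (abs_nonneg _)
    _ = _ := by rw [Finset.sum_mul]

/-- **`|∑_{p∈s}∑_{q∈t} W(e q - e p) f_p g_q| ≤ Λ_f·(∑_t|g|)`** with `Λ_f ≥ sup_q ∑_s |W(e q - e p)||f_p|`. [folklore] -/
theorem abs_sum_sum_W_mul_le_sup' {M : ℕ} (s t : Finset (ModeBox M)) (f g : ModeBox M → ℝ) {Λf : ℝ}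
    (hΛ : ∀ q ∈ t, ∑ p ∈ s, |W v ρ (e M q - e M p)| * |f p| ≤ Λf) :
    |∑ p ∈ s, ∑ q ∈ t, W v ρ (e M q - e M p) * (f p * g q)| ≤ Λf * ∑ q ∈ t, |g q| := by
  rw [Finset.sum_comm]
  calc _ ≤ ∑ q ∈ t, |∑ p ∈ s, W v ρ (e M q - e M p) * (f p * g q)| := Finset.abs_sum_le_sum_abs _ _
    _ ≤ ∑ q ∈ t, Λf * |g q| := by
        refine Finset.sum_le_sum fun q hq => (Finset.abs_sum_le_sum_abs _ _).trans ?_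
        calc ∑ p ∈ s, |W v ρ (e M q - e M p) * (f p * g q)| = (∑ p ∈ s, |W v ρ (e M q - e M p)| * |f p|) * |g q| := by
              rw [Finset.sum_mul]; exact Finset.sum_congr rfl fun p _ => by rw [abs_mul, abs_mul]; ring
          _ ≤ Λf * |g q| := mul_le_mul_of_nonneg_right (hΛ q hq) (abs_nonneg _)
    _ = _ := by rw [Finset.mul_sum]

/-- `0 ≤ S`. [folklore] -/
theorem depletion_nonneg (v : ℝ → ℝ≥0∞) (ρ : ℝ) : 0 ≤ depletion v ρ := by
  unfold depletion; exact Finset.sum_nonneg fun p _ => sq_nonneg _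

/-! ### The nine quasi-free remainders -/

section Atoms

variable (hv : Measurable v) (hint : (∫⁻ x : Space, v ‖x‖) ≠ ⊤) (hρ : 0 < ρ) (hρ1 : ρ ≤ 1)
include hv hint hρ hρ1

omit hv hint hρ1 in
/-- `L³ = ρ^{-33/10}`. [folklore] -/
theorem boxSide_pow_three : boxSide ρ ^ 3 = ρ ^ (-(33 : ℝ) / 10) := by
  unfold boxSide
  rw [← Real.rpow_natCast, ← Real.rpow_mul hρ.le]; norm_num

omit hv hint in
/-- The complement equals the filter `{ρ^{-7/5} < |n|²}`. [folklore] -/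
theorem compl_eq_filter :
    (Finset.univ \ insert (z (boxSize ρ)) (lowSet ρ)) = Finset.univ.filter (fun p : ModeBox (boxSize ρ) => ρ ^ (-(7 : ℝ) / 5) < nsq (e _ p)) := by
  ext p
  rw [Finset.mem_filter]
  constructor
  · intro hp; exact ⟨Finset.mem_univ _, (nsq_gt_of_mem_compl hp).1⟩
  · rintro ⟨-, hp⟩
    rw [Finset.mem_sdiff, Finset.mem_insert, not_or]
    have h75 : 1 ≤ ρ ^ (-(7 : ℝ) / 5) := Real.one_le_rpow_of_pos_of_le_one_of_nonpos hρ hρ1 (by norm_num)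
    refine ⟨Finset.mem_univ _, ?_, fun h => ?_⟩
    · intro h; rw [h, e_z] at hp; simp [nsq] at hp; linarith
    · exact absurd (mem_lowSet.1 h).2 (not_le.2 hp)

/-- **A₁**: `|∑_{L^c} ε(σ² - η²)| ≤ (3√3/(4π⁶))W(0)⁴ρ^{-7/10}`. [cite: BastiCenatiempoSchlein2021, Prop. 1.3 (proof)] -/
theorem atom_A1 (hsmall : W v ρ 0 / (8 * Real.pi ^ 2) * ρ ^ ((1 : ℝ) / 5) ≤ 1 / 2) :
    |∑ p ∈ (Finset.univ \ insert (z (boxSize ρ)) (lowSet ρ)),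
        eps ρ p * (Fock.bogSigma (neg _) (halfSpace _) (tAmp v ρ) p ^ 2 - eta v ρ p ^ 2)| ≤
      3 * Real.sqrt 3 / (4 * Real.pi ^ 6) * W v ρ 0 ^ 4 * ρ ^ (-(7 : ℝ) / 10) := by
  have hW0 := W_zero_nonneg v ρ
  have hnn : ∀ p ∈ (Finset.univ \ insert (z (boxSize ρ)) (lowSet ρ)),
      0 ≤ eps ρ p * (Fock.bogSigma (neg _) (halfSpace _) (tAmp v ρ) p ^ 2 - eta v ρ p ^ 2) := fun p hp =>
    mul_nonneg (eps_nonneg p) (angles_sub_eta hv hint hρ hsmall (nsq_gt_of_mem_compl hp).2.2).1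
  rw [abs_of_nonneg (Finset.sum_nonneg hnn)]
  calc _ ≤ ∑ p ∈ (Finset.univ \ insert (z (boxSize ρ)) (lowSet ρ)), 4 / 3 * (eps ρ p * eta v ρ p ^ 4) := by
        refine Finset.sum_le_sum fun p hp => ?_
        have h := (angles_sub_eta hv hint hρ hsmall (nsq_gt_of_mem_compl hp).2.2).2.1
        calc _ ≤ eps ρ p * (4 / 3 * eta v ρ p ^ 4) := mul_le_mul_of_nonneg_left h (eps_nonneg p)
          _ = _ := by ring
    _ = 4 / 3 * ∑ p ∈ (Finset.univ \ insert (z (boxSize ρ)) (lowSet ρ)), eps ρ p * eta v ρ p ^ 4 := by rw [Finset.mul_sum]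
    _ ≤ 4 / 3 * (9 * Real.sqrt 3 / (16 * Real.pi ^ 6) * W v ρ 0 ^ 4 * ρ ^ (-(1 : ℝ) / 2)) :=
        mul_le_mul_of_nonneg_left (sum_compl_eps_eta_four_le hv hint hρ) (by norm_num)
    _ = 3 * Real.sqrt 3 / (4 * Real.pi ^ 6) * W v ρ 0 ^ 4 * ρ ^ (-(1 : ℝ) / 2) := by ring
    _ ≤ _ := mul_le_mul_of_nonneg_left (Real.rpow_le_rpow_of_exponent_ge hρ hρ1 (by norm_num)) (by positivity)

omit hρ1 in
/-- **A₂**: `|(N₀/L³)∑_{L^c} W(e p)(η² + (σ² - η²) + (γσ - η))| ≤ (6√3/π⁴)W(0)³ρ^{-7/10}` (`0 ≤ N₀ ≤ N`).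
[cite: BastiCenatiempoSchlein2021, Prop. 1.3 (proof)] -/
theorem atom_A2 (hsmall : W v ρ 0 / (8 * Real.pi ^ 2) * ρ ^ ((1 : ℝ) / 5) ≤ 1 / 2) (hN₀ : 0 ≤ condensate v ρ) :
    |condensate v ρ / boxSide ρ ^ 3 * ∑ p ∈ (Finset.univ \ insert (z (boxSize ρ)) (lowSet ρ)),
        W v ρ (e (boxSize ρ) p) * (eta v ρ p ^ 2 + (Fock.bogSigma (neg _) (halfSpace _) (tAmp v ρ) p ^ 2 - eta v ρ p ^ 2) +
          (Fock.bogGamma (neg _) (halfSpace _) (tAmp v ρ) p * Fock.bogSigma (neg _) (halfSpace _) (tAmp v ρ) p - eta v ρ p))| ≤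
      6 * Real.sqrt 3 / Real.pi ^ 4 * W v ρ 0 ^ 3 * ρ ^ (-(7 : ℝ) / 10) := by
  have hW0 := W_zero_nonneg v ρ
  have hL := boxSide_pos hρ
  have hdens : condensate v ρ / boxSide ρ ^ 3 ≤ ρ := by
    have h1 : condensate v ρ ≤ particleNumber ρ := by
      unfold condensate; linarith [depletion_nonneg v ρ]
    calc condensate v ρ / boxSide ρ ^ 3 ≤ particleNumber ρ / boxSide ρ ^ 3 := div_le_div_of_nonneg_right h1 (by positivity)
      _ = ρ := by unfold particleNumber; field_simp
  have hpt : ∀ p ∈ (Finset.univ \ insert (z (boxSize ρ)) (lowSet ρ)),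
      |W v ρ (e (boxSize ρ) p) * (eta v ρ p ^ 2 + (Fock.bogSigma (neg _) (halfSpace _) (tAmp v ρ) p ^ 2 - eta v ρ p ^ 2) +
          (Fock.bogGamma (neg _) (halfSpace _) (tAmp v ρ) p * Fock.bogSigma (neg _) (halfSpace _) (tAmp v ρ) p - eta v ρ p))| ≤
        W v ρ 0 * (2 * eta v ρ p ^ 2) := by
    intro p hp
    obtain ⟨h0, h4, h3⟩ := angles_sub_eta hv hint hρ hsmall (nsq_gt_of_mem_compl hp).2.2
    have hη : |eta v ρ p| ≤ 1 / 2 := (abs_eta_le_of_not_lowSet hv hint hρ (nsq_gt_of_mem_compl hp).2.2).trans hsmall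
    have hη2 : eta v ρ p ^ 2 = |eta v ρ p| ^ 2 := (sq_abs _).symm
    rw [abs_mul]
    refine mul_le_mul (abs_W_le v ρ _) ?_ (abs_nonneg _) hW0
    calc _ ≤ |eta v ρ p ^ 2 + (Fock.bogSigma (neg _) (halfSpace _) (tAmp v ρ) p ^ 2 - eta v ρ p ^ 2)| +
          |Fock.bogGamma (neg _) (halfSpace _) (tAmp v ρ) p * Fock.bogSigma (neg _) (halfSpace _) (tAmp v ρ) p - eta v ρ p| :=
          abs_add_le _ _
      _ ≤ (eta v ρ p ^ 2 + 4 / 3 * eta v ρ p ^ 4) + 4 / 3 * |eta v ρ p| ^ 3 := by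
          refine add_le_add ?_ h3
          rw [abs_of_nonneg (by positivity)]; linarith
      _ ≤ 2 * eta v ρ p ^ 2 := by
          rw [hη2]
          have ha := abs_nonneg (eta v ρ p)
          nlinarith [mul_le_mul_of_nonneg_left hη ha, pow_le_pow_left₀ ha hη 2]
  rw [abs_mul, abs_of_nonneg (div_nonneg hN₀ (by positivity))]
  calc _ ≤ ρ * ∑ p ∈ (Finset.univ \ insert (z (boxSize ρ)) (lowSet ρ)), W v ρ 0 * (2 * eta v ρ p ^ 2) :=
        mul_le_mul hdens ((Finset.abs_sum_le_sum_abs _ _).trans (Finset.sum_le_sum hpt)) (abs_nonneg _) hρ.le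
    _ = ρ * (2 * W v ρ 0) * ∑ p ∈ (Finset.univ \ insert (z (boxSize ρ)) (lowSet ρ)), eta v ρ p ^ 2 := by
        rw [Finset.mul_sum, Finset.mul_sum]; exact Finset.sum_congr rfl fun p _ => by ring
    _ ≤ ρ * (2 * W v ρ 0) * (3 * Real.sqrt 3 / Real.pi ^ 4 * W v ρ 0 ^ 2 * ρ ^ (-(17 : ℝ) / 10)) :=
        mul_le_mul_of_nonneg_left (sum_compl_eta_sq_le hv hint hρ) (by positivity)
    _ = 6 * Real.sqrt 3 / Real.pi ^ 4 * W v ρ 0 ^ 3 * (ρ ^ (1 : ℝ) * ρ ^ (-(17 : ℝ) / 10)) := by rw [Real.rpow_one]; ring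
    _ = _ := by rw [← Real.rpow_add hρ]; norm_num

/-- **A₃**: `|(2L³)⁻¹∑∑_{P_L} W(e q - e p)γσ_pγσ_q| ≤ ½W(0)(24/(√2π)√W(0) + 12/π²W(0))²ρ^{-7/10}`.
[cite: BastiCenatiempoSchlein2021, Prop. 1.3 (proof)] -/
theorem atom_A3 :
    |(2 * boxSide ρ ^ 3)⁻¹ * ∑ p ∈ lowSet ρ, ∑ q ∈ lowSet ρ, W v ρ (e (boxSize ρ) q - e (boxSize ρ) p) *
        ((Fock.bogGamma (neg _) (halfSpace _) (tAmp v ρ) p * Fock.bogSigma (neg _) (halfSpace _) (tAmp v ρ) p) *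
          (Fock.bogGamma (neg _) (halfSpace _) (tAmp v ρ) q * Fock.bogSigma (neg _) (halfSpace _) (tAmp v ρ) q))| ≤
      1 / 2 * W v ρ 0 * (24 / (Real.sqrt 2 * Real.pi) * Real.sqrt (W v ρ 0) + 12 / Real.pi ^ 2 * W v ρ 0) ^ 2 * ρ ^ (-(7 : ℝ) / 10) := by
  have hW0 := W_zero_nonneg v ρ
  have hL := boxSide_pos hρ
  have hgs := sum_lowSet_abs_gs_le hv hint hρ
  set C : ℝ := 24 / (Real.sqrt 2 * Real.pi) * Real.sqrt (W v ρ 0) + 12 / Real.pi ^ 2 * W v ρ 0 with hC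
  have hgs' : ∑ p ∈ lowSet ρ, |Fock.bogGamma (neg _) (halfSpace _) (tAmp v ρ) p * Fock.bogSigma (neg _) (halfSpace _) (tAmp v ρ) p| ≤
      C * ρ ^ (-(19 : ℝ) / 10) := by
    refine hgs.trans ?_
    rw [hC, add_mul]
    refine add_le_add ?_ le_rfl
    exact mul_le_mul_of_nonneg_left (Real.rpow_le_rpow_of_exponent_ge hρ hρ1 (by norm_num)) (by positivity)
  have hS0 : 0 ≤ ∑ p ∈ lowSet ρ, |Fock.bogGamma (neg _) (halfSpace _) (tAmp v ρ) p * Fock.bogSigma (neg _) (halfSpace _) (tAmp v ρ) p| :=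
    Finset.sum_nonneg fun p _ => abs_nonneg _
  rw [abs_mul, abs_inv, abs_of_pos (by positivity : (0:ℝ) < 2 * boxSide ρ ^ 3)]
  calc _ ≤ (2 * boxSide ρ ^ 3)⁻¹ * (W v ρ 0 * ((C * ρ ^ (-(19 : ℝ) / 10)) * (C * ρ ^ (-(19 : ℝ) / 10)))) := by
        refine mul_le_mul_of_nonneg_left ((abs_sum_sum_W_mul_le _ _ _ _).trans ?_) (by positivity)
        exact mul_le_mul_of_nonneg_left (mul_le_mul hgs' hgs' hS0 (by positivity)) hW0
    _ = 1 / 2 * W v ρ 0 * C ^ 2 * (ρ ^ ((33 : ℝ) / 10) * ρ ^ (-(19 : ℝ) / 10) * ρ ^ (-(19 : ℝ) / 10)) := by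
        rw [boxSide_pow_three hρ, show ρ ^ ((33 : ℝ) / 10) = (ρ ^ (-(33 : ℝ) / 10))⁻¹ by
          rw [← Real.rpow_neg hρ.le]; norm_num]
        ring
    _ = 1 / 2 * W v ρ 0 * C ^ 2 * ρ ^ (-(1 : ℝ) / 2) := by
        rw [← Real.rpow_add hρ, ← Real.rpow_add hρ]; norm_num
    _ ≤ _ := mul_le_mul_of_nonneg_left (Real.rpow_le_rpow_of_exponent_ge hρ hρ1 (by norm_num)) (by positivity)

/-- **A₄**: `|L⁻³∑_{P_L}γσ_l ∑_{L^c} W(e p - e l)(γσ_p - η_p)| ≤ (3√3/(2π⁶))(24/(√2π)√W(0) + 12/π²W(0))W(0)⁴ρ^{-7/10}`.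
[cite: BastiCenatiempoSchlein2021, Prop. 1.3 (proof)] -/
theorem atom_A4 (hsmall : W v ρ 0 / (8 * Real.pi ^ 2) * ρ ^ ((1 : ℝ) / 5) ≤ 1 / 2) :
    |(boxSide ρ ^ 3)⁻¹ * ∑ l ∈ lowSet ρ, (Fock.bogGamma (neg _) (halfSpace _) (tAmp v ρ) l * Fock.bogSigma (neg _) (halfSpace _) (tAmp v ρ) l) *
        ∑ p ∈ (Finset.univ \ insert (z (boxSize ρ)) (lowSet ρ)), W v ρ (e (boxSize ρ) p - e (boxSize ρ) l) *
          ((Fock.bogGamma (neg _) (halfSpace _) (tAmp v ρ) p * Fock.bogSigma (neg _) (halfSpace _) (tAmp v ρ) p) - eta v ρ p)| ≤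
      3 * Real.sqrt 3 / (2 * Real.pi ^ 6) * (24 / (Real.sqrt 2 * Real.pi) * Real.sqrt (W v ρ 0) + 12 / Real.pi ^ 2 * W v ρ 0) *
        W v ρ 0 ^ 4 * ρ ^ (-(7 : ℝ) / 10) := by
  have hW0 := W_zero_nonneg v ρ
  have hL := boxSide_pos hρ
  set C : ℝ := 24 / (Real.sqrt 2 * Real.pi) * Real.sqrt (W v ρ 0) + 12 / Real.pi ^ 2 * W v ρ 0 with hC
  have hgs' : ∑ p ∈ lowSet ρ, |Fock.bogGamma (neg _) (halfSpace _) (tAmp v ρ) p * Fock.bogSigma (neg _) (halfSpace _) (tAmp v ρ) p| ≤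
      C * ρ ^ (-(19 : ℝ) / 10) := by
    refine (sum_lowSet_abs_gs_le hv hint hρ).trans ?_
    rw [hC, add_mul]
    refine add_le_add ?_ le_rfl
    exact mul_le_mul_of_nonneg_left (Real.rpow_le_rpow_of_exponent_ge hρ hρ1 (by norm_num)) (by positivity)
  have h3 : ∑ p ∈ (Finset.univ \ insert (z (boxSize ρ)) (lowSet ρ)),
      |(Fock.bogGamma (neg _) (halfSpace _) (tAmp v ρ) p * Fock.bogSigma (neg _) (halfSpace _) (tAmp v ρ) p) - eta v ρ p| ≤
      4 / 3 * (9 * Real.sqrt 3 / (8 * Real.pi ^ 6) * W v ρ 0 ^ 3 * ρ ^ (-(3 : ℝ) / 2)) := by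
    calc _ ≤ ∑ p ∈ (Finset.univ \ insert (z (boxSize ρ)) (lowSet ρ)), 4 / 3 * |eta v ρ p| ^ 3 :=
          Finset.sum_le_sum fun p hp => (angles_sub_eta hv hint hρ hsmall (nsq_gt_of_mem_compl hp).2.2).2.2
      _ = 4 / 3 * ∑ p ∈ (Finset.univ \ insert (z (boxSize ρ)) (lowSet ρ)), |eta v ρ p| ^ 3 := by rw [Finset.mul_sum]
      _ ≤ _ := mul_le_mul_of_nonneg_left (sum_compl_abs_eta_cube_le hv hint hρ) (by norm_num)
  have hS0 : 0 ≤ ∑ p ∈ lowSet ρ, |Fock.bogGamma (neg _) (halfSpace _) (tAmp v ρ) p * Fock.bogSigma (neg _) (halfSpace _) (tAmp v ρ) p| :=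
    Finset.sum_nonneg fun p _ => abs_nonneg _
  rw [abs_mul, abs_inv, abs_of_pos (by positivity : (0:ℝ) < boxSide ρ ^ 3)]
  calc _ ≤ (boxSide ρ ^ 3)⁻¹ * (W v ρ 0 * ((C * ρ ^ (-(19 : ℝ) / 10)) *
        (4 / 3 * (9 * Real.sqrt 3 / (8 * Real.pi ^ 6) * W v ρ 0 ^ 3 * ρ ^ (-(3 : ℝ) / 2))))) := by
        refine mul_le_mul_of_nonneg_left ((abs_sum_mul_sum_W_le _ _ _ _).trans ?_) (by positivity)
        exact mul_le_mul_of_nonneg_left (mul_le_mul hgs' h3 (Finset.sum_nonneg fun p _ => abs_nonneg _) (by positivity)) hW0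
    _ = 3 * Real.sqrt 3 / (2 * Real.pi ^ 6) * C * W v ρ 0 ^ 4 * (ρ ^ ((33 : ℝ) / 10) * ρ ^ (-(19 : ℝ) / 10) * ρ ^ (-(3 : ℝ) / 2)) := by
        rw [boxSide_pow_three hρ, show (ρ ^ (-(33 : ℝ) / 10))⁻¹ = ρ ^ ((33 : ℝ) / 10) by
          rw [← Real.rpow_neg hρ.le]; norm_num]
        ring
    _ = 3 * Real.sqrt 3 / (2 * Real.pi ^ 6) * C * W v ρ 0 ^ 4 * ρ ^ (-(1 : ℝ) / 10) := by
        rw [← Real.rpow_add hρ, ← Real.rpow_add hρ]; norm_num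
    _ ≤ _ := mul_le_mul_of_nonneg_left (Real.rpow_le_rpow_of_exponent_ge hρ hρ1 (by norm_num)) (by positivity)

/-- **A₆**: `|∑∑ W(e q - e p)σ_p²σ_q²/(2L³)| ≤ ½W(0)C_S²ρ^{-7/10}`. [cite: BastiCenatiempoSchlein2021, Prop. 1.3 (proof)] -/
theorem atom_A6 :
    |(∑ p, ∑ q, W v ρ (e (boxSize ρ) q - e (boxSize ρ) p) *
        (Fock.bogSigma (neg _) (halfSpace _) (tAmp v ρ) p ^ 2 * Fock.bogSigma (neg _) (halfSpace _) (tAmp v ρ) q ^ 2)) / (2 * boxSide ρ ^ 3)| ≤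
      1 / 2 * W v ρ 0 * (24 / (Real.sqrt 2 * Real.pi) * Real.sqrt (W v ρ 0) + 10 * Real.sqrt 3 / Real.pi ^ 4 * W v ρ 0 ^ 2) ^ 2 *
        ρ ^ (-(7 : ℝ) / 10) := by
  have hW0 := W_zero_nonneg v ρ
  have hL := boxSide_pos hρ
  have hS := depletion_le hv hint hρ hρ1
  set C : ℝ := 24 / (Real.sqrt 2 * Real.pi) * Real.sqrt (W v ρ 0) + 10 * Real.sqrt 3 / Real.pi ^ 4 * W v ρ 0 ^ 2 with hC
  have hSabs : ∑ p, |Fock.bogSigma (neg _) (halfSpace _) (tAmp v ρ) p ^ 2| = depletion v ρ := by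
    unfold depletion; exact Finset.sum_congr rfl fun p _ => abs_of_nonneg (sq_nonneg _)
  have hS0 := depletion_nonneg v ρ
  rw [abs_div, abs_of_pos (by positivity : (0:ℝ) < 2 * boxSide ρ ^ 3), div_eq_inv_mul]
  calc _ ≤ (2 * boxSide ρ ^ 3)⁻¹ * (W v ρ 0 * ((C * ρ ^ (-(9 : ℝ) / 5)) * (C * ρ ^ (-(9 : ℝ) / 5)))) := by
        refine mul_le_mul_of_nonneg_left ((abs_sum_sum_W_mul_le _ _ _ _).trans ?_) (by positivity)
        rw [hSabs]
        exact mul_le_mul_of_nonneg_left (mul_le_mul hS hS hS0 (by positivity)) hW0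
    _ = 1 / 2 * W v ρ 0 * C ^ 2 * (ρ ^ ((33 : ℝ) / 10) * ρ ^ (-(9 : ℝ) / 5) * ρ ^ (-(9 : ℝ) / 5)) := by
        rw [boxSide_pow_three hρ, show ρ ^ ((33 : ℝ) / 10) = (ρ ^ (-(33 : ℝ) / 10))⁻¹ by
          rw [← Real.rpow_neg hρ.le]; norm_num]
        ring
    _ = 1 / 2 * W v ρ 0 * C ^ 2 * ρ ^ (-(3 : ℝ) / 10) := by
        rw [← Real.rpow_add hρ, ← Real.rpow_add hρ]; norm_num
    _ ≤ _ := mul_le_mul_of_nonneg_left (Real.rpow_le_rpow_of_exponent_ge hρ hρ1 (by norm_num)) (by positivity)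

/-- **A₇**: `|(S/L³)∑_{P_L} W(e l)(σ_l² + γσ_l)| ≤ W(0)C_S(C_σ + C_gs)ρ^{-7/10}`. [cite: BastiCenatiempoSchlein2021, Prop. 1.3 (proof)] -/
theorem atom_A7 :
    |depletion v ρ / boxSide ρ ^ 3 * ∑ l ∈ lowSet ρ, W v ρ (e (boxSize ρ) l) *
        (Fock.bogSigma (neg _) (halfSpace _) (tAmp v ρ) l ^ 2 +
          Fock.bogGamma (neg _) (halfSpace _) (tAmp v ρ) l * Fock.bogSigma (neg _) (halfSpace _) (tAmp v ρ) l)| ≤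
      W v ρ 0 * (24 / (Real.sqrt 2 * Real.pi) * Real.sqrt (W v ρ 0) + 10 * Real.sqrt 3 / Real.pi ^ 4 * W v ρ 0 ^ 2) *
        ((24 / (Real.sqrt 2 * Real.pi) * Real.sqrt (W v ρ 0) + 6 * Real.sqrt 3 / Real.pi ^ 4 * W v ρ 0 ^ 2) +
          (24 / (Real.sqrt 2 * Real.pi) * Real.sqrt (W v ρ 0) + 12 / Real.pi ^ 2 * W v ρ 0)) * ρ ^ (-(7 : ℝ) / 10) := by
  have hW0 := W_zero_nonneg v ρ
  have hL := boxSide_pos hρ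
  have hS := depletion_le hv hint hρ hρ1
  have hS0 := depletion_nonneg v ρ
  set CS : ℝ := 24 / (Real.sqrt 2 * Real.pi) * Real.sqrt (W v ρ 0) + 10 * Real.sqrt 3 / Real.pi ^ 4 * W v ρ 0 ^ 2 with hCS
  set Cσ : ℝ := 24 / (Real.sqrt 2 * Real.pi) * Real.sqrt (W v ρ 0) + 6 * Real.sqrt 3 / Real.pi ^ 4 * W v ρ 0 ^ 2 with hCσ
  set Cg : ℝ := 24 / (Real.sqrt 2 * Real.pi) * Real.sqrt (W v ρ 0) + 12 / Real.pi ^ 2 * W v ρ 0 with hCg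
  have hσ : ∑ p ∈ lowSet ρ, Fock.bogSigma (neg _) (halfSpace _) (tAmp v ρ) p ^ 2 ≤ Cσ * ρ ^ (-(19 : ℝ) / 10) :=
    (sum_lowSet_sigma_sq_le hv hint hρ).trans
      (mul_le_mul_of_nonneg_left (Real.rpow_le_rpow_of_exponent_ge hρ hρ1 (by norm_num)) (by positivity))
  have hgs : ∑ p ∈ lowSet ρ, |Fock.bogGamma (neg _) (halfSpace _) (tAmp v ρ) p * Fock.bogSigma (neg _) (halfSpace _) (tAmp v ρ) p| ≤
      Cg * ρ ^ (-(19 : ℝ) / 10) := by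
    refine (sum_lowSet_abs_gs_le hv hint hρ).trans ?_
    rw [hCg, add_mul]
    refine add_le_add ?_ le_rfl
    exact mul_le_mul_of_nonneg_left (Real.rpow_le_rpow_of_exponent_ge hρ hρ1 (by norm_num)) (by positivity)
  have hsum : |∑ l ∈ lowSet ρ, W v ρ (e (boxSize ρ) l) *
        (Fock.bogSigma (neg _) (halfSpace _) (tAmp v ρ) l ^ 2 +
          Fock.bogGamma (neg _) (halfSpace _) (tAmp v ρ) l * Fock.bogSigma (neg _) (halfSpace _) (tAmp v ρ) l)| ≤
      W v ρ 0 * ((Cσ + Cg) * ρ ^ (-(19 : ℝ) / 10)) := by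
    calc _ ≤ ∑ l ∈ lowSet ρ, W v ρ 0 * (Fock.bogSigma (neg _) (halfSpace _) (tAmp v ρ) l ^ 2 +
          |Fock.bogGamma (neg _) (halfSpace _) (tAmp v ρ) l * Fock.bogSigma (neg _) (halfSpace _) (tAmp v ρ) l|) := by
          refine (Finset.abs_sum_le_sum_abs _ _).trans (Finset.sum_le_sum fun l _ => ?_)
          rw [abs_mul]
          refine mul_le_mul (abs_W_le v ρ _) ((abs_add_le _ _).trans (by rw [abs_of_nonneg (sq_nonneg _)])) (abs_nonneg _) hW0
      _ = W v ρ 0 * (∑ l ∈ lowSet ρ, Fock.bogSigma (neg _) (halfSpace _) (tAmp v ρ) l ^ 2 +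
            ∑ l ∈ lowSet ρ, |Fock.bogGamma (neg _) (halfSpace _) (tAmp v ρ) l * Fock.bogSigma (neg _) (halfSpace _) (tAmp v ρ) l|) := by
          rw [← Finset.sum_add_distrib, Finset.mul_sum]
      _ ≤ _ := by rw [add_mul]; exact mul_le_mul_of_nonneg_left (add_le_add hσ hgs) hW0
  rw [abs_mul, abs_of_nonneg (div_nonneg hS0 (by positivity))]
  calc _ ≤ (CS * ρ ^ (-(9 : ℝ) / 5)) / boxSide ρ ^ 3 * (W v ρ 0 * ((Cσ + Cg) * ρ ^ (-(19 : ℝ) / 10))) :=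
        mul_le_mul (div_le_div_of_nonneg_right hS (by positivity)) hsum (abs_nonneg _) (by positivity)
    _ = W v ρ 0 * CS * (Cσ + Cg) * (ρ ^ ((33 : ℝ) / 10) * ρ ^ (-(9 : ℝ) / 5) * ρ ^ (-(19 : ℝ) / 10)) := by
        rw [boxSide_pow_three hρ, show ρ ^ ((33 : ℝ) / 10) = (ρ ^ (-(33 : ℝ) / 10))⁻¹ by
          rw [← Real.rpow_neg hρ.le]; norm_num]
        field_simp
    _ = W v ρ 0 * CS * (Cσ + Cg) * ρ ^ (-(2 : ℝ) / 5) := by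
        rw [← Real.rpow_add hρ, ← Real.rpow_add hρ]; norm_num
    _ ≤ _ := mul_le_mul_of_nonneg_left (Real.rpow_le_rpow_of_exponent_ge hρ hρ1 (by norm_num)) (by positivity)

/-- **A₈**: `|L⁻³∑_{P_L}(σ² + γσ)_l ∑_{P_L} W(e q - e l)η_q| ≤ W(0)(C_σ + C_gs)(12/π²)W(0)ρ^{-7/10}`.
[cite: BastiCenatiempoSchlein2021, Prop. 1.3 (proof)] -/
theorem atom_A8 :
    |(boxSide ρ ^ 3)⁻¹ * ∑ l ∈ lowSet ρ, (Fock.bogSigma (neg _) (halfSpace _) (tAmp v ρ) l ^ 2 +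
        Fock.bogGamma (neg _) (halfSpace _) (tAmp v ρ) l * Fock.bogSigma (neg _) (halfSpace _) (tAmp v ρ) l) *
          ∑ q ∈ lowSet ρ, W v ρ (e (boxSize ρ) q - e (boxSize ρ) l) * eta v ρ q| ≤
      W v ρ 0 * ((24 / (Real.sqrt 2 * Real.pi) * Real.sqrt (W v ρ 0) + 6 * Real.sqrt 3 / Real.pi ^ 4 * W v ρ 0 ^ 2) +
          (24 / (Real.sqrt 2 * Real.pi) * Real.sqrt (W v ρ 0) + 12 / Real.pi ^ 2 * W v ρ 0)) *
        (12 / Real.pi ^ 2 * W v ρ 0) * ρ ^ (-(7 : ℝ) / 10) := by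
  have hW0 := W_zero_nonneg v ρ
  have hL := boxSide_pos hρ
  set Cσ : ℝ := 24 / (Real.sqrt 2 * Real.pi) * Real.sqrt (W v ρ 0) + 6 * Real.sqrt 3 / Real.pi ^ 4 * W v ρ 0 ^ 2 with hCσ
  set Cg : ℝ := 24 / (Real.sqrt 2 * Real.pi) * Real.sqrt (W v ρ 0) + 12 / Real.pi ^ 2 * W v ρ 0 with hCg
  have hσ : ∑ p ∈ lowSet ρ, Fock.bogSigma (neg _) (halfSpace _) (tAmp v ρ) p ^ 2 ≤ Cσ * ρ ^ (-(19 : ℝ) / 10) :=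
    (sum_lowSet_sigma_sq_le hv hint hρ).trans
      (mul_le_mul_of_nonneg_left (Real.rpow_le_rpow_of_exponent_ge hρ hρ1 (by norm_num)) (by positivity))
  have hgs : ∑ p ∈ lowSet ρ, |Fock.bogGamma (neg _) (halfSpace _) (tAmp v ρ) p * Fock.bogSigma (neg _) (halfSpace _) (tAmp v ρ) p| ≤
      Cg * ρ ^ (-(19 : ℝ) / 10) := by
    refine (sum_lowSet_abs_gs_le hv hint hρ).trans ?_
    rw [hCg, add_mul]
    refine add_le_add ?_ le_rfl
    exact mul_le_mul_of_nonneg_left (Real.rpow_le_rpow_of_exponent_ge hρ hρ1 (by norm_num)) (by positivity)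
  have hf : ∑ l ∈ lowSet ρ, |Fock.bogSigma (neg _) (halfSpace _) (tAmp v ρ) l ^ 2 +
        Fock.bogGamma (neg _) (halfSpace _) (tAmp v ρ) l * Fock.bogSigma (neg _) (halfSpace _) (tAmp v ρ) l| ≤
      (Cσ + Cg) * ρ ^ (-(19 : ℝ) / 10) := by
    calc _ ≤ ∑ l ∈ lowSet ρ, (Fock.bogSigma (neg _) (halfSpace _) (tAmp v ρ) l ^ 2 +
          |Fock.bogGamma (neg _) (halfSpace _) (tAmp v ρ) l * Fock.bogSigma (neg _) (halfSpace _) (tAmp v ρ) l|) :=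
          Finset.sum_le_sum fun l _ => (abs_add_le _ _).trans (by rw [abs_of_nonneg (sq_nonneg _)])
      _ ≤ _ := by rw [Finset.sum_add_distrib, add_mul]; exact add_le_add hσ hgs
  have hη := sum_lowSet_abs_eta_le hv hint hρ
  rw [abs_mul, abs_inv, abs_of_pos (by positivity : (0:ℝ) < boxSide ρ ^ 3)]
  calc _ ≤ (boxSide ρ ^ 3)⁻¹ * (W v ρ 0 * (((Cσ + Cg) * ρ ^ (-(19 : ℝ) / 10)) * (12 / Real.pi ^ 2 * W v ρ 0 * ρ ^ (-(19 : ℝ) / 10)))) := by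
        refine mul_le_mul_of_nonneg_left ((abs_sum_mul_sum_W_le _ _ _ _).trans ?_) (by positivity)
        exact mul_le_mul_of_nonneg_left (mul_le_mul hf hη (Finset.sum_nonneg fun p _ => abs_nonneg _) (by positivity)) hW0
    _ = W v ρ 0 * (Cσ + Cg) * (12 / Real.pi ^ 2 * W v ρ 0) * (ρ ^ ((33 : ℝ) / 10) * ρ ^ (-(19 : ℝ) / 10) * ρ ^ (-(19 : ℝ) / 10)) := by
        rw [boxSide_pow_three hρ, show (ρ ^ (-(33 : ℝ) / 10))⁻¹ = ρ ^ ((33 : ℝ) / 10) by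
          rw [← Real.rpow_neg hρ.le]; norm_num]
        ring
    _ = W v ρ 0 * (Cσ + Cg) * (12 / Real.pi ^ 2 * W v ρ 0) * ρ ^ (-(1 : ℝ) / 2) := by
        rw [← Real.rpow_add hρ, ← Real.rpow_add hρ]; norm_num
    _ ≤ _ := mul_le_mul_of_nonneg_left (Real.rpow_le_rpow_of_exponent_ge hρ hρ1 (by norm_num)) (by positivity)

/-- **A₉**: `|(2L³)⁻¹∑_{P_L}η_l ∑_{P_L} W(e q - e l)η_q| ≤ ½W(0)(12/π²W(0))²ρ^{-7/10}`.
[cite: BastiCenatiempoSchlein2021, Prop. 1.3 (proof)] -/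
theorem atom_A9 :
    |(2 * boxSide ρ ^ 3)⁻¹ * ∑ l ∈ lowSet ρ, eta v ρ l * ∑ q ∈ lowSet ρ, W v ρ (e (boxSize ρ) q - e (boxSize ρ) l) * eta v ρ q| ≤
      1 / 2 * W v ρ 0 * (12 / Real.pi ^ 2 * W v ρ 0) ^ 2 * ρ ^ (-(7 : ℝ) / 10) := by
  have hW0 := W_zero_nonneg v ρ
  have hL := boxSide_pos hρ
  have hη := sum_lowSet_abs_eta_le hv hint hρ
  rw [abs_mul, abs_inv, abs_of_pos (by positivity : (0:ℝ) < 2 * boxSide ρ ^ 3)]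
  calc _ ≤ (2 * boxSide ρ ^ 3)⁻¹ * (W v ρ 0 * ((12 / Real.pi ^ 2 * W v ρ 0 * ρ ^ (-(19 : ℝ) / 10)) *
        (12 / Real.pi ^ 2 * W v ρ 0 * ρ ^ (-(19 : ℝ) / 10)))) := by
        refine mul_le_mul_of_nonneg_left ((abs_sum_mul_sum_W_le _ _ _ _).trans ?_) (by positivity)
        exact mul_le_mul_of_nonneg_left (mul_le_mul hη hη (Finset.sum_nonneg fun p _ => abs_nonneg _) (by positivity)) hW0
    _ = 1 / 2 * W v ρ 0 * (12 / Real.pi ^ 2 * W v ρ 0) ^ 2 * (ρ ^ ((33 : ℝ) / 10) * ρ ^ (-(19 : ℝ) / 10) * ρ ^ (-(19 : ℝ) / 10)) := by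
        rw [boxSide_pow_three hρ, show ρ ^ ((33 : ℝ) / 10) = (ρ ^ (-(33 : ℝ) / 10))⁻¹ by
          rw [← Real.rpow_neg hρ.le]; norm_num]
        ring
    _ = 1 / 2 * W v ρ 0 * (12 / Real.pi ^ 2 * W v ρ 0) ^ 2 * ρ ^ (-(1 : ℝ) / 2) := by
        rw [← Real.rpow_add hρ, ← Real.rpow_add hρ]; norm_num
    _ ≤ _ := mul_le_mul_of_nonneg_left (Real.rpow_le_rpow_of_exponent_ge hρ hρ1 (by norm_num)) (by positivity)

/-- **The `η`-convolution sup off `P_L`**: `∑_{q∈L^c} |W(e q - e p)||η_q| ≤ c·(96W(0)ρ^{-11/10} + √(192√3)‖v‖₂L)`,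
`c = ρW(0)L²/(8π²)`. [cite: BastiCenatiempoSchlein2021, (2.4)] -/
theorem sum_compl_abs_W_mul_abs_eta_le {R₀ : ℝ} (hsupp : ∀ r, R₀ < r → v r = 0) (hR : 2 * R₀ < boxSide ρ)
    (h2 : (∫⁻ z : Space, v ‖z‖ ^ 2) ≠ ⊤) (k : Momentum) :
    ∑ q ∈ (Finset.univ \ insert (z (boxSize ρ)) (lowSet ρ)), |W v ρ (e _ q - k)| * |eta v ρ q| ≤
      ρ * W v ρ 0 * boxSide ρ ^ 2 / (8 * Real.pi ^ 2) *
        (96 * W v ρ 0 * ρ ^ (-(11 : ℝ) / 10) +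
          Real.sqrt (192 * Real.sqrt 3) * Real.sqrt (∫ z : Space, (v ‖z‖).toReal ^ 2) * boxSide ρ) := by
  have hW0 := W_zero_nonneg v ρ
  have hL := boxSide_pos hρ
  have hCW := sum_abs_W_div_nsq_le hv hsupp hρ hR h2 k
  rw [← compl_eq_filter hρ hρ1] at hCW
  set c : ℝ := ρ * W v ρ 0 * boxSide ρ ^ 2 / (8 * Real.pi ^ 2) with hc
  calc _ ≤ ∑ q ∈ (Finset.univ \ insert (z (boxSize ρ)) (lowSet ρ)), c * (|W v ρ (k - e _ q)| * (nsq (e _ q))⁻¹) := by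
        refine Finset.sum_le_sum fun q hq => ?_
        obtain ⟨hn, hqz, -⟩ := nsq_gt_of_mem_compl hq
        have hnp : 0 < nsq (e _ q) := (Real.rpow_pos_of_pos hρ _).trans hn
        have hη := abs_eta_le hv hint hρ hqz
        have hWe : |W v ρ (e _ q - k)| = |W v ρ (k - e _ q)| := by rw [← W_neg, neg_sub]
        rw [hWe]
        calc _ ≤ |W v ρ (k - e _ q)| * (ρ * W v ρ 0 * boxSide ρ ^ 2 / (8 * Real.pi ^ 2 * nsq (e _ q))) :=
              mul_le_mul_of_nonneg_left hη (abs_nonneg _)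
          _ = _ := by rw [hc]; field_simp
    _ = c * ∑ q ∈ (Finset.univ \ insert (z (boxSize ρ)) (lowSet ρ)), |W v ρ (k - e _ q)| * (nsq (e _ q))⁻¹ := by rw [Finset.mul_sum]
    _ ≤ _ := mul_le_mul_of_nonneg_left hCW (by positivity)

/-- **A₅**: `|(2L³)⁻¹∑∑_{L^c} W(e q - e p)[(γσ_p-η_p)η_q + η_p(γσ_q-η_q) + (γσ_p-η_p)(γσ_q-η_q)]| ≤ C₅ρ^{-7/10}`,
`C₅ = (3√3/(16π⁸))W(0)⁴(96W(0) + √(192√3)‖v‖₂) + (27/(8π¹²))W(0)⁷`. [cite: BastiCenatiempoSchlein2021, Prop. 1.3 (proof)] -/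
theorem atom_A5 (hsmall : W v ρ 0 / (8 * Real.pi ^ 2) * ρ ^ ((1 : ℝ) / 5) ≤ 1 / 2)
    {R₀ : ℝ} (hsupp : ∀ r, R₀ < r → v r = 0) (hR : 2 * R₀ < boxSide ρ) (h2 : (∫⁻ z : Space, v ‖z‖ ^ 2) ≠ ⊤) :
    |(2 * boxSide ρ ^ 3)⁻¹ * ∑ p ∈ (Finset.univ \ insert (z (boxSize ρ)) (lowSet ρ)), ∑ q ∈ (Finset.univ \ insert (z (boxSize ρ)) (lowSet ρ)),
        W v ρ (e (boxSize ρ) q - e (boxSize ρ) p) *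
          (((Fock.bogGamma (neg _) (halfSpace _) (tAmp v ρ) p * Fock.bogSigma (neg _) (halfSpace _) (tAmp v ρ) p) - eta v ρ p) * eta v ρ q +
            eta v ρ p * ((Fock.bogGamma (neg _) (halfSpace _) (tAmp v ρ) q * Fock.bogSigma (neg _) (halfSpace _) (tAmp v ρ) q) - eta v ρ q) +
            ((Fock.bogGamma (neg _) (halfSpace _) (tAmp v ρ) p * Fock.bogSigma (neg _) (halfSpace _) (tAmp v ρ) p) - eta v ρ p) *
              ((Fock.bogGamma (neg _) (halfSpace _) (tAmp v ρ) q * Fock.bogSigma (neg _) (halfSpace _) (tAmp v ρ) q) - eta v ρ q))| ≤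
      (3 * Real.sqrt 3 / (16 * Real.pi ^ 8) * W v ρ 0 ^ 4 *
          (96 * W v ρ 0 + Real.sqrt (192 * Real.sqrt 3) * Real.sqrt (∫ z : Space, (v ‖z‖).toReal ^ 2)) +
        27 / (8 * Real.pi ^ 12) * W v ρ 0 ^ 7) * ρ ^ (-(7 : ℝ) / 10) := by
  have hW0 := W_zero_nonneg v ρ
  have hL := boxSide_pos hρ
  set Lc := (Finset.univ \ insert (z (boxSize ρ)) (lowSet ρ)) with hLc
  set d : ModeBox (boxSize ρ) → ℝ := fun p =>
    (Fock.bogGamma (neg _) (halfSpace _) (tAmp v ρ) p * Fock.bogSigma (neg _) (halfSpace _) (tAmp v ρ) p) - eta v ρ p with hd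
  set I₂ : ℝ := Real.sqrt (∫ z : Space, (v ‖z‖).toReal ^ 2) with hI₂
  have hI₂0 : 0 ≤ I₂ := Real.sqrt_nonneg _
  set c : ℝ := ρ * W v ρ 0 * boxSide ρ ^ 2 / (8 * Real.pi ^ 2) with hc
  set CW : ℝ := 96 * W v ρ 0 * ρ ^ (-(11 : ℝ) / 10) + Real.sqrt (192 * Real.sqrt 3) * I₂ * boxSide ρ with hCW
  have hc0 : 0 ≤ c := by positivity
  have hCW0 : 0 ≤ CW := by positivity
  -- `D = ∑ |d| ≤ (3√3/(2π⁶))W0³ρ^{-3/2}`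
  set D : ℝ := ∑ p ∈ Lc, |d p| with hD
  have hD0 : 0 ≤ D := Finset.sum_nonneg fun p _ => abs_nonneg _
  have hDle : D ≤ 3 * Real.sqrt 3 / (2 * Real.pi ^ 6) * W v ρ 0 ^ 3 * ρ ^ (-(3 : ℝ) / 2) := by
    calc D ≤ ∑ p ∈ Lc, 4 / 3 * |eta v ρ p| ^ 3 :=
          Finset.sum_le_sum fun p hp => (angles_sub_eta hv hint hρ hsmall (nsq_gt_of_mem_compl hp).2.2).2.2
      _ = 4 / 3 * ∑ p ∈ Lc, |eta v ρ p| ^ 3 := by rw [Finset.mul_sum]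
      _ ≤ 4 / 3 * (9 * Real.sqrt 3 / (8 * Real.pi ^ 6) * W v ρ 0 ^ 3 * ρ ^ (-(3 : ℝ) / 2)) :=
          mul_le_mul_of_nonneg_left (sum_compl_abs_eta_cube_le hv hint hρ) (by norm_num)
      _ = _ := by ring
  -- the sup
  have hΛ : ∀ p ∈ Lc, ∑ q ∈ Lc, |W v ρ (e _ q - e _ p)| * |eta v ρ q| ≤ c * CW := fun p _ =>
    sum_compl_abs_W_mul_abs_eta_le hv hint hρ hρ1 hsupp hR h2 (e _ p)
  -- split the sum
  have hΛ' : ∀ q ∈ Lc, ∑ p ∈ Lc, |W v ρ (e _ q - e _ p)| * |eta v ρ p| ≤ c * CW := fun q _ => by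
    have h := sum_compl_abs_W_mul_abs_eta_le hv hint hρ hρ1 hsupp hR h2 (e _ q)
    refine le_trans (le_of_eq (Finset.sum_congr rfl fun p _ => ?_)) h
    rw [← W_neg, neg_sub]
  have hsplit : ∑ p ∈ Lc, ∑ q ∈ Lc, W v ρ (e _ q - e _ p) * (d p * eta v ρ q + eta v ρ p * d q + d p * d q) =
      (∑ p ∈ Lc, ∑ q ∈ Lc, W v ρ (e _ q - e _ p) * (d p * eta v ρ q)) +
        (∑ p ∈ Lc, ∑ q ∈ Lc, W v ρ (e _ q - e _ p) * (eta v ρ p * d q)) +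
        ∑ p ∈ Lc, ∑ q ∈ Lc, W v ρ (e _ q - e _ p) * (d p * d q) := by
    rw [← Finset.sum_add_distrib, ← Finset.sum_add_distrib]
    refine Finset.sum_congr rfl fun p _ => ?_
    rw [← Finset.sum_add_distrib, ← Finset.sum_add_distrib]
    refine Finset.sum_congr rfl fun q _ => ?_
    ring
  have h1 : |∑ p ∈ Lc, ∑ q ∈ Lc, W v ρ (e _ q - e _ p) * (d p * eta v ρ q)| ≤ D * (c * CW) :=
    abs_sum_sum_W_mul_le_sup _ _ _ _ hΛ
  have h2' : |∑ p ∈ Lc, ∑ q ∈ Lc, W v ρ (e _ q - e _ p) * (eta v ρ p * d q)| ≤ (c * CW) * D :=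
    abs_sum_sum_W_mul_le_sup' _ _ _ _ hΛ'
  have h3 : |∑ p ∈ Lc, ∑ q ∈ Lc, W v ρ (e _ q - e _ p) * (d p * d q)| ≤ W v ρ 0 * (D * D) :=
    abs_sum_sum_W_mul_le _ _ _ _
  have hmain : |∑ p ∈ Lc, ∑ q ∈ Lc, W v ρ (e _ q - e _ p) * (d p * eta v ρ q + eta v ρ p * d q + d p * d q)| ≤
      2 * (D * (c * CW)) + W v ρ 0 * (D * D) := by
    rw [hsplit]
    refine (abs_add_le _ _).trans ?_
    have := abs_add_le (∑ p ∈ Lc, ∑ q ∈ Lc, W v ρ (e _ q - e _ p) * (d p * eta v ρ q))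
      (∑ p ∈ Lc, ∑ q ∈ Lc, W v ρ (e _ q - e _ p) * (eta v ρ p * d q))
    nlinarith
  rw [abs_mul, abs_inv, abs_of_pos (by positivity : (0:ℝ) < 2 * boxSide ρ ^ 3)]
  have hDcCW : D * (c * CW) ≤ (3 * Real.sqrt 3 / (2 * Real.pi ^ 6) * W v ρ 0 ^ 3 * ρ ^ (-(3 : ℝ) / 2)) * (c * CW) :=
    mul_le_mul_of_nonneg_right hDle (by positivity)
  have hDD : D * D ≤ (3 * Real.sqrt 3 / (2 * Real.pi ^ 6) * W v ρ 0 ^ 3 * ρ ^ (-(3 : ℝ) / 2)) *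
      (3 * Real.sqrt 3 / (2 * Real.pi ^ 6) * W v ρ 0 ^ 3 * ρ ^ (-(3 : ℝ) / 2)) := mul_le_mul hDle hDle hD0 (by positivity)
  calc _ ≤ (2 * boxSide ρ ^ 3)⁻¹ * (2 * ((3 * Real.sqrt 3 / (2 * Real.pi ^ 6) * W v ρ 0 ^ 3 * ρ ^ (-(3 : ℝ) / 2)) * (c * CW)) +
        W v ρ 0 * ((3 * Real.sqrt 3 / (2 * Real.pi ^ 6) * W v ρ 0 ^ 3 * ρ ^ (-(3 : ℝ) / 2)) *
          (3 * Real.sqrt 3 / (2 * Real.pi ^ 6) * W v ρ 0 ^ 3 * ρ ^ (-(3 : ℝ) / 2)))) := by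
        refine mul_le_mul_of_nonneg_left (hmain.trans ?_) (by positivity)
        nlinarith [mul_le_mul_of_nonneg_left hDD hW0]
    _ = 3 * Real.sqrt 3 / (16 * Real.pi ^ 8) * W v ρ 0 ^ 4 * (96 * W v ρ 0) *
            (ρ ^ ((33 : ℝ) / 10) * ρ ^ (-(3 : ℝ) / 2) * ρ ^ (1 : ℝ) * ρ ^ (-(11 : ℝ) / 5) * ρ ^ (-(11 : ℝ) / 10)) +
          3 * Real.sqrt 3 / (16 * Real.pi ^ 8) * W v ρ 0 ^ 4 * (Real.sqrt (192 * Real.sqrt 3) * I₂) *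
            (ρ ^ ((33 : ℝ) / 10) * ρ ^ (-(3 : ℝ) / 2) * ρ ^ (1 : ℝ) * ρ ^ (-(11 : ℝ) / 5) * ρ ^ (-(11 : ℝ) / 10)) +
          1 / 2 * W v ρ 0 * (3 * Real.sqrt 3 / (2 * Real.pi ^ 6) * W v ρ 0 ^ 3) ^ 2 *
            (ρ ^ ((33 : ℝ) / 10) * ρ ^ (-(3 : ℝ) / 2) * ρ ^ (-(3 : ℝ) / 2)) := by
        rw [hc, hCW, boxSide_sq hρ, boxSide_pow_three hρ, Real.rpow_one,
          show ρ ^ ((33 : ℝ) / 10) = (ρ ^ (-(33 : ℝ) / 10))⁻¹ by rw [← Real.rpow_neg hρ.le]; norm_num,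
          show boxSide ρ = ρ ^ (-(11 : ℝ) / 10) from rfl]
        field_simp
        ring
    _ = 3 * Real.sqrt 3 / (16 * Real.pi ^ 8) * W v ρ 0 ^ 4 * (96 * W v ρ 0) * ρ ^ (-(1 : ℝ) / 2) +
          3 * Real.sqrt 3 / (16 * Real.pi ^ 8) * W v ρ 0 ^ 4 * (Real.sqrt (192 * Real.sqrt 3) * I₂) * ρ ^ (-(1 : ℝ) / 2) +
          1 / 2 * W v ρ 0 * (3 * Real.sqrt 3 / (2 * Real.pi ^ 6) * W v ρ 0 ^ 3) ^ 2 * ρ ^ ((3 : ℝ) / 10) := by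
        simp only [← Real.rpow_add hρ]; norm_num
    _ ≤ 3 * Real.sqrt 3 / (16 * Real.pi ^ 8) * W v ρ 0 ^ 4 * (96 * W v ρ 0) * ρ ^ (-(7 : ℝ) / 10) +
          3 * Real.sqrt 3 / (16 * Real.pi ^ 8) * W v ρ 0 ^ 4 * (Real.sqrt (192 * Real.sqrt 3) * I₂) * ρ ^ (-(7 : ℝ) / 10) +
          1 / 2 * W v ρ 0 * (3 * Real.sqrt 3 / (2 * Real.pi ^ 6) * W v ρ 0 ^ 3) ^ 2 * ρ ^ (-(7 : ℝ) / 10) := by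
        have h1 := Real.rpow_le_rpow_of_exponent_ge hρ hρ1 (show (-(7 : ℝ) / 10) ≤ -(1 : ℝ) / 2 by norm_num)
        have h2 := Real.rpow_le_rpow_of_exponent_ge hρ hρ1 (show (-(7 : ℝ) / 10) ≤ (3 : ℝ) / 10 by norm_num)
        refine add_le_add (add_le_add ?_ ?_) ?_
        · exact mul_le_mul_of_nonneg_left h1 (by positivity)
        · exact mul_le_mul_of_nonneg_left h1 (by positivity)
        · exact mul_le_mul_of_nonneg_left h2 (by positivity)
    _ = _ := by
        have h27 : Real.sqrt 3 ^ 2 = 3 := Real.sq_sqrt (by norm_num)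
        linear_combination (1 / 2 * W v ρ 0 ^ 7 * 9 / (4 * Real.pi ^ 12) * ρ ^ (-(7 : ℝ) / 10)) * h27

end Atoms



end BCSTrial

end Literature.MathematicalPhysics.QuantumManyBody.BoseGas

end
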